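import Literature.NumberTheory.EllipticCurves.HeegnerModuleIndex
import Literature.NumberTheory.EllipticCurves.HeegnerPointsOfConductorRationalityProofs
import Literature.NumberTheory.EllipticCurves.TwistedHeegnerFamilyExistence
import Literature.NumberTheory.EllipticCurves.ModularCurveNonempty
import HarnessLib

/-!
# Heegner points of every conductor `c` prime to `N` exist in `E(K̄)`, are fixed by `Gal(K̄/K[c])`,
# and have norms to the layers `K_n` — discharge of the named fact `exists_isHeegnerNormPoint`

Topic `NumberTheory/EllipticCurves` (the CM input of the Heegner-module files: Howard 2004 §2.7/§3.3,
Perrin-Riou 1987 §3.1–3.4, Gross 1991 §3). Theorems only (no definition, no named fact; net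
Literature debt `−1`).

The named fact `Literature.NumberTheory.EllipticCurves.exists_isHeegnerNormPoint N W K p`
(`HeegnerModuleIndex.lean`, *"the CM input of the whole theory"*; consumers:
`nonempty_heegnerFamily_of` (Heegner families / the Heegner module `ℋ_∞`),
`TwistedHeegnerFamilyExistence.nonempty_twistedHeegnerFamily_of`, `TwistedHeegnerTransportSign`,
`KellerYin2024/HeegnerPairDataExistence` (Keller–Yin Thm. 5.2.1 data), `CornutVatsal2007/CMPointsNontriviality`)
asks, for `W/ℚ` elliptic with a parametrisation datum `Dt` at level `N`, `K` imaginary quadratic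
satisfying the Heegner hypothesis for `N`, an orientation `β` (`4N ∣ β² − d_K`), an embedding
`jbar : K̄ → ℂ`, a `ℤ_p`-extension `κ`, a layer `n` and a conductor `c` prime to `N`, for a geometric
point `z ∈ E(K̄)` which `IsHeegnerNormPoint`: `z = ∑_{r ∈ R} r • x` for a Heegner point `x` of
conductor `c` (`complexPoint x = φ(τ_Q)`, `Q` a Heegner form of level `N`, discriminant `d_K c²`,
`B ≡ cβ (mod 2N)`) fixed by `Gal(K̄/K[c]) = ringClassSubgroup K c jbar`, and `R ⊆ Gal(K̄/K_n)` a
transversal of `Gal(K̄/K_n K[c])` in `Gal(K̄/K_n)`.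

It is PROVED here from theorems of the tree:

* **rationality** — Gross 1991 §3 / Darmon 2004 Thm. 3.6, the tree's theorem
  `phi_heegnerPointOfConductor_mem_range_map_ringClassField_holds` (`HeegnerPointsOfConductorRationalityProofs`):
  `y(c) = φ(x(c)) ∈ E(K[c])` for the concrete ring class field `K[c] = ringClassField K ι c ⊂ ℂ`,
  `ι = jbar ∘ (K → K̄)`, and `x(c)` is the root of the Heegner form of conductor `c`
  (`heegnerFormOfConductor_mem_heegnerForms`: level `N`, discriminant `c²d_K`, residue `cβ`);
* **transfer to `K̄`** — `K[c] ⊆ jbar(K̄)` (`mem_range_of_mem_ringClassField`, `K[c]/K` finite) gives the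
  coordinates of `y(c)` as `jbar`-values of a point `x ∈ E(K̄)`, and every `σ ∈ ringClassSubgroup K c jbar`
  fixes the `jbar`-preimage of any element of `K[c]` (`smul_eq_self_of_mem_ringClassSubgroup`,
  `TwistedHeegnerFamilyExistence`), hence fixes `x`;
* **the transversal** — `ringClassSubgroup K c jbar` has finite index in `Γ_K` (it is the pointwise
  stabiliser of the finitely many `jbar`-preimages of the singular moduli of discriminant `d_K c²`, each
  algebraic over `K`, so each stabiliser has finite index by orbit–stabiliser), so its trace on
  `Gal(K̄/K_n)` has a finite left transversal (Mathlib `Subgroup.exists_isComplement_left`,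
  `Subgroup.IsComplement.finite_left`);
* the degenerate conductor `c = 0` forces `N = 1`, where no parametrisation datum exists
  (`ModularParametrizationData_isEmpty_of_mem_genusZeroLevels`, `S₂(Γ₀(1)) = 0`).

HONEST FRAMING: classical CM theory (Gross 1991 §3 "the point `x_n` is rational over `K_n`"; Howard
2004 §2.7 "`P[m] ∈ E(K[m])`") assembled from the tree's proved Shimura-reciprocity files plus group
theory; no statement about `L`-functions, Selmer groups or BSD is made. For the consumers listed above
one carried HYPOTHESIS `(hH : exists_isHeegnerNormPoint N W K p)` becomes a theorem; nothing else changes.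
Found by the ARM-P cited-input audit (cell `pub/bsd-cited`, seat r10, base-role discharge).

## References

* [Howard2004HeegnerKolyvagin] B. Howard, *The Heegner point Kolyvagin system*, Compos. Math. 140
  (2004), §2.7 and §3.3.
* [GrossLMS1991] B. H. Gross, *Kolyvagin's work on modular elliptic curves*, LMS LN 153 (1991), §3
  (p. 238: `x_n` rational over `K_n`, `y_n = φ(x_n) ∈ E(K_n)`).
* [Darmon2004] H. Darmon, *Rational points on modular elliptic curves*, CBMS 101 (2004), Thm. 3.6.
* [PerrinRiou1987BSMF] B. Perrin-Riou, Bull. SMF 115 (1987), §3.1–§3.4.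
* [Cox2013] D. A. Cox, *Primes of the form x² + ny²*, 2nd ed., Thm. 11.1.

## Mathlib / tree search

Tree, by name: `phi_heegnerPointOfConductor_mem_range_map_ringClassField_holds`,
`heegnerFormOfConductor_mem_heegnerForms`, `mem_range_of_mem_ringClassField`,
`smul_eq_self_of_mem_ringClassSubgroup`, `ModularParametrizationData_isEmpty_of_mem_genusZeroLevels`,
`Affine.Point.congrEquiv_some`; Mathlib: `MulAction.orbitEquivQuotientStabilizer`,
`Subgroup.finiteIndex_of_finite_quotient`, `Subgroup.finiteIndex_iInf`, `Subgroup.index_comap_of_surjective`,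
`Subgroup.exists_isComplement_left`, `Subgroup.isComplement_iff_existsUnique_inv_mul_mem`,
`Subgroup.IsComplement.finite_left`. `rg 'exists_isHeegnerNormPoint_holds'` over `lean/`: no prior discharge.
-/

noncomputable section

open scoped Classical

universe u

namespace Literature.NumberTheory.EllipticCurves

open _root_.WeierstrassCurve
open Literature.NumberTheory.EllipticCurves.ModularForms
open Literature.NumberTheory.QuadraticFields.BinaryQuadraticForm (reducedForms)

section FiniteIndex

variable (K : Type u) [Field K]

/-- The stabiliser in `Aut_K(K̄)` of an element of `K̄` has finite index: its orbit is contained in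
the (finite) root set of the minimal polynomial (orbit–stabiliser). [folklore] -/
private theorem finiteIndex_stabilizer_algebraicClosure (a : AlgebraicClosure K) :
    (MulAction.stabilizer (AlgebraicClosure K ≃ₐ[K] AlgebraicClosure K) a).FiniteIndex := by
  have hint : IsIntegral K a := (Algebra.IsAlgebraic.isAlgebraic (R := K) a).isIntegral
  have hfo : (MulAction.orbit (AlgebraicClosure K ≃ₐ[K] AlgebraicClosure K) a).Finite := by
    refine ((minpoly K a).rootSet_finite (AlgebraicClosure K)).subset ?_
    intro y hy
    obtain ⟨σ, rfl⟩ := hy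
    rw [Polynomial.mem_rootSet]
    refine ⟨minpoly.ne_zero hint, ?_⟩
    show Polynomial.aeval (σ a) (minpoly K a) = 0
    rw [Polynomial.aeval_algHom_apply, minpoly.aeval, map_zero]
  haveI : Finite (MulAction.orbit (AlgebraicClosure K ≃ₐ[K] AlgebraicClosure K) a) := hfo.to_subtype
  haveI : Finite ((AlgebraicClosure K ≃ₐ[K] AlgebraicClosure K) ⧸
      MulAction.stabilizer (AlgebraicClosure K ≃ₐ[K] AlgebraicClosure K) a) :=
    Finite.of_equiv _ (MulAction.orbitEquivQuotientStabilizer _ a)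
  exact Subgroup.finiteIndex_of_finite_quotient

/-- **`Gal(K̄/K[c])` has finite index in `Γ_K`**: `ringClassSubgroup K c jbar` is the pointwise
stabiliser of the finitely many `jbar`-preimages of the singular moduli of discriminant `d_K c²`
(Cox Thm. 11.1: `K[c] = K(j(𝒪_c))` is a finite extension of `K`). [cite: Cox2013, Thm. 11.1] -/
theorem finiteIndex_ringClassSubgroup [NumberField K] (c : ℕ) (jbar : AlgebraicClosure K →+* ℂ) :
    (ringClassSubgroup K c jbar).FiniteIndex := by
  set A : Set (AlgebraicClosure K) :=
    {a | jbar a ∈ (reducedForms (NumberField.discr K * (c : ℤ) ^ 2)).image formJ} with hA_def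
  have hA : A.Finite := by
    rw [hA_def]
    exact (Finset.finite_toSet _).preimage jbar.injective.injOn
  haveI : Finite A := hA.to_subtype
  have hinf : (⨅ a ∈ A, MulAction.stabilizer (AlgebraicClosure K ≃ₐ[K] AlgebraicClosure K) a).FiniteIndex := by
    rw [iInf_subtype']
    exact Subgroup.finiteIndex_iInf fun x ↦ finiteIndex_stabilizer_algebraicClosure K x.1
  rw [ringClassSubgroup, Subgroup.finiteIndex_iff,
    Subgroup.index_comap_of_surjective _ (f := (Field.absoluteGaloisGroup.toAlgEquiv K).toMonoidHom)
      (Field.absoluteGaloisGroup.toAlgEquiv K).surjective]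
  exact hinf.index_ne_zero

end FiniteIndex

section Transversal

variable {Γ : Type*} [Group Γ]

/-- **Finite left transversals of a finite-index subgroup inside another subgroup**: for subgroups
`G, H` of a group with `G` of finite index there is a finite `R ⊆ H` meeting every class
`{r ∈ H : r⁻¹τ ∈ G}`, `τ ∈ H`, exactly once (a left transversal of `G ∩ H` in `H`). Pure group theory
(Mathlib `Subgroup.exists_isComplement_left`). [folklore] -/
private theorem exists_finset_transversal (G H : Subgroup Γ) [G.FiniteIndex] :
    ∃ R : Finset Γ, (↑R ⊆ (H : Set Γ)) ∧ ∀ τ ∈ H, ∃! r, r ∈ R ∧ r⁻¹ * τ ∈ G := by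
  obtain ⟨S, hS, -⟩ := (G.subgroupOf H).exists_isComplement_left 1
  have hSfin : S.Finite := hS.finite_left
  refine ⟨hSfin.toFinset.image (fun s : H ↦ (s : Γ)), ?_, fun τ hτ ↦ ?_⟩
  · intro r hr
    obtain ⟨s, -, rfl⟩ := Finset.mem_image.mp (Finset.mem_coe.mp hr)
    exact s.2
  · obtain ⟨s, hs1, hs2⟩ :=
      Subgroup.isComplement_iff_existsUnique_inv_mul_mem.mp hS ⟨τ, hτ⟩
    rw [SetLike.mem_coe, Subgroup.mem_subgroupOf, Subgroup.coe_mul, Subgroup.coe_inv] at hs1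
    refine ⟨((s : H) : Γ), ⟨Finset.mem_image.mpr ⟨s, hSfin.mem_toFinset.mpr s.2, rfl⟩, hs1⟩, ?_⟩
    rintro r ⟨hr, hrG⟩
    obtain ⟨s', hs', rfl⟩ := Finset.mem_image.mp hr
    have hs'S : s' ∈ S := hSfin.mem_toFinset.mp hs'
    have h := hs2 ⟨s', hs'S⟩ (by
      show ((s' : H)⁻¹ * ⟨τ, hτ⟩ : H) ∈ ((G.subgroupOf H : Subgroup H) : Set H)
      rw [SetLike.mem_coe, Subgroup.mem_subgroupOf, Subgroup.coe_mul, Subgroup.coe_inv]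
      exact hrG)
    rw [← h]

end Transversal

/-! The parameters of the named fact; the discharge is the closed statement at every `(N, W, K, p)`. -/
variable (N : ℕ) [NeZero N] (W : WeierstrassCurve ℚ) (K : Type u) [Field K] [NumberField K]
  (p : ℕ) [Fact p.Prime]

/-- **Howard 2004 §2.7/§3.3 ∘ Gross 1991 §3 ∘ Darmon 2004 Thm. 3.6, PROVED: Heegner norm points of
every conductor `c` prime to `N` exist** — the named fact `exists_isHeegnerNormPoint N W K p`,
discharged: for `W/ℚ` elliptic, `K` imaginary quadratic Heegner for `N`, every `ℤ_p`-extension `κ`,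
datum `Dt`, orientation `β`, embedding `jbar : K̄ → ℂ`, layer `n` and `c` coprime to `N` there is
`z = ∑_{r ∈ R} r • x ∈ E(K̄)` with `x` the Heegner point of conductor `c` (`complexPoint x = φ(x(c))`),
fixed by `Gal(K̄/K[c])`, `R` a finite transversal in `Gal(K̄/K_n)`.
[cite: Howard2004HeegnerKolyvagin, §2.7 and §3.3] [cite: GrossLMS1991, §3 (p. 238)]
[cite: Darmon2004, Thm. 3.6 (PDF p. 43)] -/
theorem exists_isHeegnerNormPoint_holds : exists_isHeegnerNormPoint N W K p := by
  intro _ hK hH κ Dt β hβ jbar n c hcN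
  -- the degenerate conductor `c = 0` forces `N = 1`, where no datum exists
  rcases Nat.eq_zero_or_pos c with rfl | hcpos
  · exfalso
    have hN : N = 1 := by simpa using hcN
    subst hN
    exact (ModularParametrizationData_isEmpty_of_mem_genusZeroLevels W 1 (by simp)).false Dt
  have hc : c ≠ 0 := hcpos.ne'
  set Kbar := AlgebraicClosure K
  set ι : K →+* ℂ := jbar.comp (algebraMap K Kbar) with hι
  set G := ringClassSubgroup K c jbar with hG
  -- (1) rationality over the concrete ring class field `K[c] ⊂ ℂ`
  obtain ⟨P, hP⟩ := phi_heegnerPointOfConductor_mem_range_map_ringClassField_holds N W K hK hH Dt β ι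
    c hβ hc hcN
  obtain ⟨hQ, hQβ⟩ := heegnerFormOfConductor_mem_heegnerForms (N := N) hK.discr_neg hβ hc
  set Q := heegnerFormOfConductor (NumberField.discr K) β c with hQ_def
  have hQ' : Q ∈ heegnerForms N (NumberField.discr K * (c : ℤ) ^ 2) := by rwa [mul_comm]
  -- the curve equality behind `complexPoint`
  have hbc : (W.baseChange K).map (Algebra.ofId K Kbar : K →+* Kbar) = W.baseChange Kbar :=
    W.map_baseChange (Algebra.ofId K Kbar)
  -- (2) transfer to `E(K̄)`: a point `x` with `complexPoint x = φ(x(c))`, fixed by `G`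
  have key : ∃ x : geomPoints (W.baseChange K),
      complexPoint W jbar x = Dt.φ (heegnerTau Q) ∧ ∀ σ ∈ G, σ • x = x := by
    rcases hPc : P with _ | ⟨u, v, huv⟩
    · refine ⟨0, ?_, fun σ _ ↦ smul_zero σ⟩
      rw [map_zero]
      have h := hP
      rw [hPc] at h
      change WeierstrassCurve.Affine.Point.map _ 0 = _ at h
      rw [map_zero] at h
      simpa [heegnerPointComplexOfConductor, heegnerPointOfConductor] using h
    · -- coordinates as `jbar`-values
      obtain ⟨a, ha⟩ := mem_range_of_mem_ringClassField hK jbar hc u.2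
      obtain ⟨b, hb⟩ := mem_range_of_mem_ringClassField hK jbar hc v.2
      have huvC : (W.baseChange ℂ).toAffine.Nonsingular (u : ℂ) (v : ℂ) :=
        (WeierstrassCurve.Affine.baseChange_nonsingular W
          (f := (ringClassField K ι c).subtype.toRatAlgHom) (ringClassField K ι c).subtype.injective
          u v).mpr huv
      have hab : (W.baseChange Kbar).toAffine.Nonsingular a b := by
        rw [← WeierstrassCurve.Affine.baseChange_nonsingular W (f := jbar.toRatAlgHom) jbar.injective a b]
        simpa [ha, hb] using huvC
      have hab' : ((W.baseChange K).map (Algebra.ofId K Kbar : K →+* Kbar)).toAffine.Nonsingular a b := by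
        rw [hbc]; exact hab
      refine ⟨.some a b hab', ?_, fun σ hσ ↦ ?_⟩
      · -- `complexPoint (a, b) = (jbar a, jbar b) = (u, v) = φ(x(c))`
        have h1 : complexPoint W jbar (.some a b hab') =
            WeierstrassCurve.Affine.Point.map jbar.toRatAlgHom
              (WeierstrassCurve.Affine.Point.congrEquiv hbc (.some a b hab')) := rfl
        rw [h1, WeierstrassCurve.Affine.Point.congrEquiv_some hbc hab',
          WeierstrassCurve.Affine.Point.map_some]
        have h2 := hP
        rw [hPc, WeierstrassCurve.Affine.Point.map_some] at h2
        simp only [RingHom.toRatAlgHom_apply, Subfield.coe_subtype, ha, hb] at h2 ⊢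
        rw [h2]
        rfl
      · -- `σ ∈ Gal(K̄/K[c])` fixes `a, b` (their `jbar`-images lie in `K[c]`)
        have hσa : σ • a = a :=
          smul_eq_self_of_mem_ringClassSubgroup hK jbar hc hσ (by rw [ha]; exact u.2)
        have hσb : σ • b = b :=
          smul_eq_self_of_mem_ringClassSubgroup hK jbar hc hσ (by rw [hb]; exact v.2)
        rw [Field.absoluteGaloisGroup.smul_def] at hσa hσb
        change WeierstrassCurve.Affine.Point.map
          ((Field.absoluteGaloisGroup.toAlgEquiv K σ : Kbar ≃ₐ[K] Kbar) : Kbar →ₐ[K] Kbar)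
          (.some a b hab') = .some a b hab'
        rw [WeierstrassCurve.Affine.Point.map_some]
        simp only [AlgEquiv.coe_toAlgHom, hσa, hσb]
  obtain ⟨x, hx, hfix⟩ := key
  -- (3) a finite transversal of `G ∩ Gal(K̄/K_n)` in `Gal(K̄/K_n)`
  haveI : G.FiniteIndex := finiteIndex_ringClassSubgroup K c jbar
  obtain ⟨R, hRsub, htrans⟩ := exists_finset_transversal G (κ.layerSubgroup n)
  exact ⟨∑ r ∈ R, r • x, x, R, ⟨Q, hQ', hQβ, hx⟩, hfix, hRsub, htrans, rfl⟩

/-! ### Tied Heegner families (the witness of `nonempty_heegnerFamily_of` with its datum exposed)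

A `HeegnerFamily N W K κ jbar` carries its OWN parametrisation datum `F.Dt`; the existence theorem
`nonempty_heegnerFamily_of` (`HeegnerModuleIndex.lean`) hides the witness's datum behind `Nonempty`.
Statements that PIN the Heegner class to a given parametrisation — print's normalisation: the
Heegner classes are built with ONE fixed parametrisation whose Manin constant is a `p`-adic unit
(Burungale–Castella–Kim, ANT 15 (2021), Remark after Conj. 1.1: Perrin-Riou's Conj. B carries the
factor `c_π · #𝒪_K^×/2`, "`c_π` is a `p`-adic unit by [Mazur] and our hypothesis that `p ∤ N`";
Castella–Grossi–Lee–Skinner, Invent. Math. 227 (2022), Conj. 1: `char(X_tors) = (c_E² u_K²)⁻¹ ·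
char(𝒮/Λκ₁^Hg)²`) — are typed with the tie `F.Dt = Dt` to a frame datum `Dt` with `¬ (p : ℤ) ∣ Dt.c`
(cell `pub/bsd-print-x9`, planner finding PIN-1, 2026-08-28). The two theorems below discharge such
tied existentials: same proof term as `nonempty_heegnerFamily_of`, with `F.Dt = Dt ∧ F.β = β` kept. -/

variable {N W K p} in
/-- **Tied Heegner families exist**: under the Heegner hypothesis for `N` with `p ∤ N`, for EVERY
parametrisation datum `Dt`, orientation `β` (`4N ∣ β² − d_K`), embedding `jbar : K̄ → ℂ` and
`ℤ_p`-extension `κ` there is a Heegner family `F` along `κ` WITH `F.Dt = Dt` and `F.β = β` (`y` of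
conductor `1` over `K`, `z j` of conductor `p^{j+1}` over `K_j`, from `exists_isHeegnerNormPoint`).
One-line re-run of `nonempty_heegnerFamily_of`, whose anonymous-constructor witness is
`⟨Dt, β, hβ, y, hy, z, hz⟩`. [cite: Howard2004HeegnerKolyvagin, §2.7 and §3.3] -/
theorem exists_heegnerFamily_Dt_eq (h : exists_isHeegnerNormPoint N W K p) [W.IsElliptic]
    (hK : IsImaginaryQuadratic K) (hH : SatisfiesHeegnerHypothesis N K) (hp : ¬ p ∣ N)
    (κ : ZpExtension K p) (Dt : ModularParametrizationData W N) {β : ℤ}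
    (hβ : (4 * N : ℤ) ∣ β ^ 2 - NumberField.discr K) (jbar : AlgebraicClosure K →+* ℂ) :
    ∃ F : HeegnerFamily N W K κ jbar, F.Dt = Dt ∧ F.β = β := by
  have hc : ∀ j : ℕ, (p ^ (j + 1)).Coprime N := fun j ↦
    Nat.Coprime.pow_left _ ((Fact.out : p.Prime).coprime_iff_not_dvd.mpr hp)
  choose z hz using fun j : ℕ ↦ h hK hH κ Dt hβ jbar j (hc j)
  obtain ⟨y, hy⟩ := h hK hH κ Dt hβ jbar 0 (Nat.coprime_one_left N)
  exact ⟨⟨Dt, β, hβ, y, hy, z, hz⟩, rfl, rfl⟩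

variable {N W K p} in
/-- **Tied Heegner families exist, unconditionally**: `exists_heegnerFamily_Dt_eq` fed with the
discharge `exists_isHeegnerNormPoint_holds` of this file — for every datum `Dt` with the frame's
hypotheses there is `F : HeegnerFamily N W K κ jbar` with `F.Dt = Dt ∧ F.β = β`.
[cite: Howard2004HeegnerKolyvagin, §2.7 and §3.3] [cite: GrossLMS1991, §3 (p. 238)]
[cite: Darmon2004, Thm. 3.6 (PDF p. 43)] -/
theorem exists_heegnerFamily_Dt_eq_holds [W.IsElliptic]
    (hK : IsImaginaryQuadratic K) (hH : SatisfiesHeegnerHypothesis N K) (hp : ¬ p ∣ N)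
    (κ : ZpExtension K p) (Dt : ModularParametrizationData W N) {β : ℤ}
    (hβ : (4 * N : ℤ) ∣ β ^ 2 - NumberField.discr K) (jbar : AlgebraicClosure K →+* ℂ) :
    ∃ F : HeegnerFamily N W K κ jbar, F.Dt = Dt ∧ F.β = β :=
  exists_heegnerFamily_Dt_eq (exists_isHeegnerNormPoint_holds N W K p) hK hH hp κ Dt hβ jbar

end Literature.NumberTheory.EllipticCurves

end
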